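import Summits.BirchSwinnertonDyer.Rank1Residual.P2.CMKolyvaginPointSystemHlocAssembly
import Summits.BirchSwinnertonDyer.BirchSwinnertonDyer.Theorems.CMKolyvaginAtInertTwoPointSystemAtTwoOfPrintedInputs
import Summits.BirchSwinnertonDyer.BirchSwinnertonDyer.Theorems.CMKolyvaginAtInertTwoLevelZeroPrimeHeegnerBSDTwo
import Summits.BirchSwinnertonDyer.Rank1Residual.P2.CMKolyvaginTamagawaSelmerAtTwo
import Summits.BirchSwinnertonDyer.Rank1Residual.P2.CMKolyvaginRationalDescentPlumbingAtTwo
import Literature.NumberTheory.EllipticCurves.Darmon2004.HeegnerPointReflectionProofs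
import HarnessLib

/-!
# Route `CMKolyvaginAtInertTwo`, crux `CMKolyvaginExactAtInertTwo` (stmt-BirchSwinnertonDyer-24277),
# DATA item (0b) on H₂: the printed binder `hGZ` (Gross–Zagier III (3.1), the `E⁰` receptacle at
# the bad places) of the `p = 2` point system ELIMINATED on the odd-Tamagawa habitat

Cell `bsd-print-cf2`, typer seat ty2 (the discharge interface: leaf predicate ⟹ the cited theorem's
hypotheses, sorry-free, Summits side). THEOREMS ONLY — no definition, no named fact, no instance, no
`sorry`; no item is closed; BSD is not proved by this.

WHAT. cmk2-p1 g9's `CMPointSystemTwo.hpoints_two_of_cmInert_of_printedInputs` (the machine's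
point-system binder `hpoints` at `p = 2` on H₂, every level `2^M`) is conditional on EXACTLY the
named fact `GrossLMS1991.prop37_2_reductionCongruence_inert N W K` (Gross Prop. 3.7 (2)) and two
cite-only printed statements in the binder shapes of x11b3's odd-`p` road: `h53` (Gross Prop. 5.3)
and `hGZ` (Gross–Zagier III (3.1): the Heegner points meet `E⁰(K̄_v)` at the bad places `v ∣ N` up
to a factor prime to `2`). `hGZ` serves only conjunct (e) of the assembly (Prop. 6.2 (1) at `v ∤ m`,
bad `v`). On H₂ the curve has `Odd W.tamagawaProduct` and `K` is a quadratic Heegner field, so EVERY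
`c_w(W_K)` is odd and Prop. 6.2 (1) at `2^M` holds at every finite `w ∤ m` — bad places and `w ∣ 2`
included — by the coprimality road `gcd(2^M, c_w) = 1` (ty2 g23,
`TamagawaSelmerAtTwo.kolyvaginClass_mem_selmerLocalKer_two_pow_of_not_mem`), with no `E⁰` statement.
Feeding that into the sibling assembly
`PointSystemHloc.hpoints_at_of_perLevelChoice_of_admissible_of_h44_of_hloc` (conjunct (e) as the
labelled input `hloc`):

* `hloc_of_isCoprime_localTamagawaNumber` — the Tamagawa-free road at ANY prime `p` coprime to every
  `c_w(W_K)` at the bad places (for other cells: K7t at `2` on the Sylvester family, odd `p ∤ ∏ c_w`);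
* **`hloc_two_of_odd_tamagawaProduct`** — `p = 2`, `N = N_E`, `Odd W.tamagawaProduct`, `K` imaginary
  quadratic Heegner: `hloc` UNCONDITIONALLY;
* **`hpoints_two_of_cmInert_of_oddTamagawa`** — cmk2-p1 g9's binder with `hGZ` REPLACED by the
  habitat predicate `Odd W.tamagawaProduct`: conditional on EXACTLY
  {`prop37_2_reductionCongruence_inert N W K`, `h53`};
  `nonempty_pointSystemFamily_two_of_cmInert_of_oddTamagawa` — ty2's DATA
  `Nonempty (PointSystemFamily N W K P 2 S)` for every support `S`, same inputs.
* §3–§4: the LEVEL-ZERO CLASS THEOREM on H₂ for a prime Heegner field with the point system, the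
  plumbing and the place `u` supplied by name (`…_of_oddTamagawa_of_print`, binder `h53` displayed),
  and BY NAME throughout (`bsdp_two_of_levelZero_primeHeegner_of_print`: `h53` fed by the Literature
  named fact `Darmon2004.prop311_complexConjugation`, Darmon 2004 Prop. 3.11 = Gross 1991 Prop. 5.3).

HONEST FRAMING: a RE-THREADING of x11b3's assembly through ty2 g23's Tamagawa road; no new
mathematics; `h53` (Gross Prop. 5.3: complex conjugation on `y_m` is `−ε ×` a Galois conjugate up to
torsion) and Prop. 3.7 (2) (named fact) REMAIN the printed inputs; beyond print: NO (Gross §6 proves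
6.2 (1) at `v ∣ N` via [GZ86, III (3.1)]; the coprimality variant is McCallum's Lemma 4.3 / Milne
I.3.8 bookkeeping, valid because every `c_w` is odd on H₂). BSD is not proved by this.

References: [GrossLMS1991] §3 Props. 3.6, 3.7, §4 (4.1), Lemma 4.3, Props. 5.3, 5.4 (1), 6.2 (1)
(pp. 244–245); [McCallumLMS1991] §4 (4)–(6), Lemma 4.3, Prop. 4.4; [GrossZagier1986] III (3.1);
[MilneADT2006] Ch. I Prop. 3.8; [Cox2013] §9.A; [Lang1987] Ch. 13 §4 Thm. 12.
-/

set_option autoImplicit false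

noncomputable section

open scoped Classical
open WeierstrassCurve Field NumberField IsDedekindDomain Finset
open Literature.NumberTheory.EllipticCurves Literature.NumberTheory.GaloisRepresentations
open Literature.NumberTheory.EllipticCurves.KolyvaginCocycle
open Literature.NumberTheory.EllipticCurves.KolyvaginEuler
open Literature.NumberTheory.EllipticCurves.RingClassField
open Literature.NumberTheory.EllipticCurves.ModularForms
open Literature.NumberTheory.EllipticCurves.Rank1Residual (CMInert)
open Summit.BirchSwinnertonDyer.Rank1Residual.X11b
open Summit.BirchSwinnertonDyer.Rank1Residual.X11b.KolyvaginAssembly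
open Summit.BirchSwinnertonDyer.BirchSwinnertonDyer.Theorems

namespace Summit.BirchSwinnertonDyer.Rank1Residual.P2.PointSystemOddTamagawa

-- `K : Type`: the tree's ring-class class field theory is universe `0`.
variable {K : Type} [Field K] [NumberField K] {N : ℕ} {W : WeierstrassCurve ℚ}

/-! ## §1 The Tamagawa roads to `hloc` -/

/-- **The Tamagawa-free road at ANY prime `p` (for other cells): `p` coprime to every local Tamagawa
number `c_w(W_K)` at the bad places ⟹ `hloc`.** For a Kolyvagin–Heegner datum `d` of level `m ≥ 1`
the local inertia at `v ∤ m` fixes `E(K[m]) ⊆ E(K̄)` (`K[m]/K` unramified off `m`, Cox §9.A — krr2's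
`KolyvaginRankRigidity.smul_toGeomPoints_eq_self_of_mem_localInertia`), so on the admissible branch
ty2 g23's `kolyvaginClass_mem_selmerLocalKer_of_inertia_of_isCoprime` (Milne I.3.8 discharged) applies
with `gcd(p^M, c_v) = 1` (`c_v = 1` at good `v`); on the junk branch the class is `0`. No admissibility
or image hypothesis is used. [cite: GrossLMS1991, Prop. 6.2 (1), pp. 244–245]
[cite: McCallumLMS1991, Lemma 4.3] [cite: MilneADT2006, Ch. I Prop. 3.8] [cite: Cox2013, §9.A] -/
theorem hloc_of_isCoprime_localTamagawaNumber [NeZero N] [W.IsElliptic] (hK : IsImaginaryQuadratic K)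
    {p : ℕ} (hp : p.Prime)
    (hcop : ∀ v : HeightOneSpectrum (𝓞 K), ¬ (W.baseChange K).HasGoodReductionAt v →
      IsCoprime (p : ℤ) (((W.baseChange K).baseChange (v.adicCompletion K)).localTamagawaNumber
        (v.adicCompletionIntegers K) : ℤ)) :
    ∀ (Dt : ModularParametrizationData W N) (β : ℤ) (ι : K →+* ℂ) {M : ℕ} (_hM : 1 ≤ M)
      {n : ℕ} (_hn : Squarefree n)
      (_hKol : ∀ q ∈ n.primeFactors, IsKolyvaginPrime N W K p q ∧ FrobEqFrobInfty W K (p ^ M) q)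
      (d : (m : ℕ) → m ∣ n → KolyvaginHeegnerData Dt β ι m)
      (_hA : ∀ (m : ℕ) (hm : m ∣ n),
        IsAdmissible (absoluteGaloisGroup K) (d m hm).pointsSubgroup ((p ^ M : ℕ) : ℤ)),
      ∀ (m : ℕ) (hm : m ∣ n) (v : HeightOneSpectrum (𝓞 K)), (m : 𝓞 K) ∉ v.asIdeal →
        (d m hm).kolyvaginClass hp M ∈
          selmerLocalKer (W.baseChange K) (v.adicCompletion K) ((p ^ M : ℕ) : ℤ) := by
  intro Dt β ι M _ n hn _ d _ m hm v hv
  haveI hEK : (W.baseChange K).IsElliptic := inferInstanceAs (W.map (algebraMap ℚ K)).IsElliptic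
  have hm0 : m ≠ 0 := ne_zero_of_dvd_ne_zero (Squarefree.ne_zero hn) hm
  -- `gcd(p^M, c_v(W_K)) = 1`: the hypothesis at a bad place, `c_v = 1` at a good one
  have hcopM : IsCoprime ((p ^ M : ℕ) : ℤ)
      (((W.baseChange K).baseChange (v.adicCompletion K)).localTamagawaNumber
        (v.adicCompletionIntegers K) : ℤ) := by
    rw [Nat.cast_pow]
    refine IsCoprime.pow_left ?_
    by_cases hgood : (W.baseChange K).HasGoodReductionAt v
    · rw [(W.baseChange K).localTamagawaNumber_eq_one_of_hasGoodReductionAt_holds v hgood,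
        Nat.cast_one]
      exact isCoprime_one_right
    · exact hcop v hgood
  by_cases h : IsAdmissible (absoluteGaloisGroup K) (d m hm).pointsSubgroup ((p ^ M : ℕ) : ℤ) ∧
      (d m hm).toGeomPoints (d m hm).derivedPoint ∈
        invPoints (absoluteGaloisGroup K) (d m hm).pointsSubgroup ((p ^ M : ℕ) : ℤ)
  · rw [(d m hm).kolyvaginClass_of_admissible hp M h.1 h.2]
    obtain ⟨𝔐, h𝔐⟩ := v.localPrimesAbove_nonempty
    exact TamagawaSelmerAtTwo.kolyvaginClass_mem_selmerLocalKer_of_inertia_of_isCoprime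
      (W.baseChange K) h.1 h.2 v h𝔐
      (fun t ht ↦ KolyvaginRankRigidity.smul_toGeomPoints_eq_self_of_mem_localInertia (d m hm) hK hm0
        hv h𝔐 ht _) hcopM
  · rw [KolyvaginHeegnerData.kolyvaginClass, dif_neg h]
    exact AddSubgroup.zero_mem _

/-- **`hloc` AT `p = 2` ON THE ODD-TAMAGAWA HEEGNER HABITAT, UNCONDITIONALLY.** For `W/ℚ` elliptic with
`Odd W.tamagawaProduct`, `N = N_E`, `K` imaginary quadratic and Heegner for `N_E`: every concrete class
`(d m hm).kolyvaginClass _ M` of every Kolyvagin–Heegner tower is Selmer at every finite `v ∤ m` — bad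
places and `v ∣ 2` included — by ty2 g23's
`TamagawaSelmerAtTwo.kolyvaginClass_mem_selmerLocalKer_two_pow_of_not_mem` (every `c_w(W_K)` is odd on
a quadratic Heegner field, so `gcd(2^M, c_w) = 1`; no `E⁰`/[GZ86 III (3.1)] statement enters). The
admissibility input and the Kolyvagin conditions are not used. [cite: GrossLMS1991, Prop. 6.2 (1),
pp. 244–245] [cite: McCallumLMS1991, Lemma 4.3] [cite: MilneADT2006, Ch. I Prop. 3.8] -/
theorem hloc_two_of_odd_tamagawaProduct [NeZero N] [W.IsElliptic] (hN : N = W.conductorNorm ℤ)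
    (hK : IsImaginaryQuadratic K) (hH : SatisfiesHeegnerHypothesis N K)
    (hodd : Odd W.tamagawaProduct) (hp : (2 : ℕ).Prime) :
    ∀ (Dt : ModularParametrizationData W N) (β : ℤ) (ι : K →+* ℂ) {M : ℕ} (_hM : 1 ≤ M)
      {n : ℕ} (_hn : Squarefree n)
      (_hKol : ∀ q ∈ n.primeFactors, IsKolyvaginPrime N W K 2 q ∧ FrobEqFrobInfty W K (2 ^ M) q)
      (d : (m : ℕ) → m ∣ n → KolyvaginHeegnerData Dt β ι m)
      (_hA : ∀ (m : ℕ) (hm : m ∣ n),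
        IsAdmissible (absoluteGaloisGroup K) (d m hm).pointsSubgroup ((2 ^ M : ℕ) : ℤ)),
      ∀ (m : ℕ) (hm : m ∣ n) (v : HeightOneSpectrum (𝓞 K)), (m : 𝓞 K) ∉ v.asIdeal →
        (d m hm).kolyvaginClass hp M ∈
          selmerLocalKer (W.baseChange K) (v.adicCompletion K) ((2 ^ M : ℕ) : ℤ) := by
  subst hN
  intro Dt β ι M _ n hn _ d _ m hm v hv
  exact TamagawaSelmerAtTwo.kolyvaginClass_mem_selmerLocalKer_two_pow_of_not_mem (d m hm) hK hH hodd
    (ne_zero_of_dvd_ne_zero (Squarefree.ne_zero hn) hm) M v hv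

/-! ## §2 The point system at `2` on H₂ with `hGZ` replaced by `Odd W.tamagawaProduct` -/

/-- **KOLYVAGIN'S POINT SYSTEM AT `p = 2` ON H₂ (the machine's binder `hpoints`, full support, every
level `2^M`) WITHOUT the Gross–Zagier III (3.1) binder** — cmk2-p1 g9's
`CMPointSystemTwo.hpoints_two_of_cmInert_of_printedInputs` with `hGZ` REPLACED by the habitat predicate
`Odd W.tamagawaProduct`: for `W/ℚ` globally minimal with CM, `2` inert in the CM field, `ρ̄_{W,2}` onto,
odd Tamagawa product; `K` imaginary quadratic with odd `d_K ≠ −3` and the Heegner hypothesis for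
`N = N_E`; `P` a Heegner point of level `N` — GIVEN the named fact `prop37_2_reductionCongruence_inert N W K`
(Gross Prop. 3.7 (2)) and the ONE printed statement `h53` (Gross Prop. 5.3) in x11b3's binder shape —
the conclusion of `hpoints_of_pointSystemFamily` with support `⊤`. Inputs as in cmk2-p1 g9's file
(`hrec`, `hCM`, `hAdm`, `h44` = tree theorems; `a_ℓ = 0` by Deuring), conjunct (e) by
`hloc_two_of_odd_tamagawaProduct`. [cite: GrossLMS1991, §3 Props. 3.6, 3.7, §4 (4.1), Lemma 4.3,
Props. 5.3, 5.4, 6.2] [cite: McCallumLMS1991, §4 (4)–(6), Lemma 4.3, Prop. 4.4]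
[cite: MilneADT2006, Ch. I Prop. 3.8] -/
theorem hpoints_two_of_cmInert_of_oddTamagawa [NeZero N] [W.IsGloballyMinimal] [W.IsElliptic]
    (hN : N = W.conductorNorm ℤ) (hCMW : W.HasCM) (hin : CMInert W 2)
    (hsurj : W.HasSurjectiveModNGaloisRep 2) (hT : Odd W.tamagawaProduct)
    (hK : IsImaginaryQuadratic K) (hodd : Odd (NumberField.discr K)) (h3 : NumberField.discr K ≠ -3)
    (hH : SatisfiesHeegnerHypothesis N K) {P : (W.baseChange K).toAffine.Point}
    (hHP : IsHeegnerPoint N W K P)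
    (h372 : GrossLMS1991.prop37_2_reductionCongruence_inert N W K)
    (h53 : ∀ [W.IsElliptic] (_hK : IsImaginaryQuadratic K) (_hH : SatisfiesHeegnerHypothesis N K)
      (Dt : ModularParametrizationData W N) (β : ℤ) (ι : K →+* ℂ) {M : ℕ}
      (_hM : 1 ≤ M) {n : ℕ} (_hn : Squarefree n)
      (_hKol : ∀ q ∈ n.primeFactors, IsKolyvaginPrime N W K 2 q ∧ FrobEqFrobInfty W K (2 ^ M) q)
      (d : (m : ℕ) → m ∣ n → KolyvaginHeegnerData Dt β ι m) (m : ℕ) (hm : m ∣ n)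
      (τm : ringClassField K ι m ≃ₐ[ℚ] ringClassField K ι m),
      (∀ x : ringClassField K ι m, ((τm x : ringClassField K ι m) : ℂ) = starRingEnd ℂ x) →
      ∃ σ' ∈ ringClassGal ι m, IsOfFinAddOrder
        (pointGalHom W (ringClassField K ι m) τm (d m hm).y -
          (-W.rootNumber) • pointGalHom W (ringClassField K ι m) σ' (d m hm).y)) :
    ∀ {M : ℕ} (_hM : 1 ≤ M)
      (hdiv : ∀ Q : geomPoints (W.baseChange K), ∃ R, ((2 ^ M : ℕ) : ℤ) • R = Q)
      (c : K ≃ₐ[ℚ] K) (_hc : c ≠ 1),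
      ∃ (ε : ℤ) (τ : AlgebraicClosure K ≃+* AlgebraicClosure K) (hτ : IsLiftOfAut c τ)
        (A : ℕ → AddSubgroup (geomPoints (W.baseChange K)))
        (hA : ∀ m, KolyvaginCocycle.IsAdmissible (Field.absoluteGaloisGroup K) (A m)
          ((2 ^ M : ℕ) : ℤ))
        (Pt : ℕ → geomPoints (W.baseChange K))
        (hPt : ∀ m, Pt m ∈
          KolyvaginCocycle.invPoints (Field.absoluteGaloisGroup K) (A m) ((2 ^ M : ℕ) : ℤ)),
        (ε = 1 ∨ ε = -1) ∧
        IsOfFinAddOrder (Affine.Point.map (W' := W) (c : K →ₐ[ℚ] K) P - ε • P) ∧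
        (∀ m, ∀ a ∈ A m, hτ.pointsMap W a ∈ A m) ∧
        Pt 1 = toGeomPoints (W.baseChange K) P ∧
        (∀ m : ℕ, Squarefree m →
          (∀ q ∈ m.primeFactors, IsKolyvaginPrime N W K 2 q ∧ FrobEqFrobInfty W K (2 ^ M) q) →
          (∃ B ∈ A m, hτ.pointsMap W (Pt m) =
            (ε * (-1) ^ m.primeFactors.card) • Pt m + ((2 ^ M : ℕ) : ℤ) • B) ∧
          (∀ v : HeightOneSpectrum (𝓞 K), (m : 𝓞 K) ∉ v.asIdeal →
            kolyvaginClass (W.baseChange K) _ hdiv (hA m) (Pt m) (hPt m) ∈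
              selmerLocalKer (W.baseChange K) (v.adicCompletion K) ((2 ^ M : ℕ) : ℤ)) ∧
          (∀ ℓ : ℕ, ℓ.Prime → ℓ ∣ m → ∀ v : HeightOneSpectrum (𝓞 K), (ℓ : 𝓞 K) ∈ v.asIdeal →
            ∀ a : ℕ, ((((2 : ℕ) : ℤ) ^ a) •
                kolyvaginClass (W.baseChange K) _ hdiv (hA m) (Pt m) (hPt m) ∈
                selmerLocalKer (W.baseChange K) (v.adicCompletion K) ((2 ^ M : ℕ) : ℤ) ↔
              (((2 : ℕ) : ℤ) ^ a) • kolyvaginClass (W.baseChange K) _ hdiv (hA (m / ℓ)) (Pt (m / ℓ))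
                  (hPt (m / ℓ)) ∈
                (W.baseChange K).torsionLocalKer (v.adicCompletion K) ((2 ^ M : ℕ) : ℤ)))) := by
  intro M hM hdiv c hc
  have h4 : NumberField.discr K ≠ -4 := fun h ↦ by
    rw [h] at hodd
    exact (Int.not_even_iff_odd.mpr hodd) ⟨-2, by norm_num⟩
  have hD34 : NumberField.discr K ≠ -3 ∧ NumberField.discr K ≠ -4 := ⟨h3, h4⟩
  refine PointSystemHloc.hpoints_at_of_perLevelChoice_of_admissible_of_h44_of_hloc hN hK hD34 hH
    hHP Nat.prime_two
    (heegnerPointOfConductor_one_galoisConj_holds N W K) ?_ h53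
    (hloc_two_of_odd_tamagawaProduct hN hK hH hT Nat.prime_two) ?_ ?_ hM hdiv c hc
  · -- `hCM`: rationality of `φ(x_m)` over `K[m]` (Gross §3 / Darmon Thm. 3.6) — a THEOREM of the tree
    intro _ hK' _ Dt β ι hβ M _ m hm _
    exact phi_heegnerPointOfConductor_mem_range_map_ringClassField_of_ne_zero N W K hK' Dt β ι m hβ
      (Squarefree.ne_zero hm)
  · -- `hAdm`: Gross Lemma 4.3 at `2` on H₂ (`ρ̄₂` onto, odd `d_K`, Heegner for `N_E`)
    subst hN
    intro Dt β ι M n hn _ d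
    exact KolyvaginAtTwo.isAdmissible_pointsSubgroup_two_of_heegner d hsurj hK hodd hH
      (Squarefree.ne_zero hn) M
  · -- `h44`: McCallum 4.4 at the (supersingular) Kolyvagin primes of `2`, from Gross 3.7 (1) (theorem),
    -- Gross 3.7 (2) (named fact) and `a_ℓ = 0` (Deuring on H₂, cmk2-p1 g9)
    subst hN
    intro _ _ hK' ι P' hHP' M' hM' Dt β' hND hD n' hn hKol d hcoh hA hPt hI
    exact SylvesterTwoUpper.h44_concrete_of_traceRelation_of_congruence_of_supersingular hK' ι hHP'
      Nat.prime_two hM'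
      (fun ℓ hℓ _ ↦
        CMPointSystemTwo.frobeniusTrace_eq_zero_of_isKolyvaginPrime_two_of_cmInert hCMW hin hsurj hℓ)
      Dt hND hD hn hKol d hcoh
      (h372.family_of_grossKolyvaginPrime rfl hK' hD34 hH Dt β' ι hn
        (fun q hq ↦ (hKol q hq).1.2.2.2.1) (fun q hq ↦ (hKol q hq).1) d)
      hA hPt hI

/-- **Item (0b) on H₂ as ty2's structure, without the Gross–Zagier III (3.1) binder**: under the
hypotheses of `hpoints_two_of_cmInert_of_oddTamagawa`, `Nonempty (PointSystemFamily N W K P 2 S)` for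
EVERY support `S` (in particular the route's CM-inert support and the prime-level packages `(· = ℓ)`),
modulo EXACTLY {`prop37_2_reductionCongruence_inert N W K`, `h53`}. [cite: GrossLMS1991, §3 Props. 3.6,
3.7, §4 (4.1), Lemma 4.3, Props. 5.3, 5.4, 6.2] [cite: McCallumLMS1991, §4 Prop. 4.4]
[cite: MilneADT2006, Ch. I Prop. 3.8] -/
theorem nonempty_pointSystemFamily_two_of_cmInert_of_oddTamagawa [NeZero N] [W.IsGloballyMinimal]
    [W.IsElliptic] (hN : N = W.conductorNorm ℤ) (hCMW : W.HasCM) (hin : CMInert W 2)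
    (hsurj : W.HasSurjectiveModNGaloisRep 2) (hT : Odd W.tamagawaProduct)
    (hK : IsImaginaryQuadratic K) (hodd : Odd (NumberField.discr K)) (h3 : NumberField.discr K ≠ -3)
    (hH : SatisfiesHeegnerHypothesis N K) {P : (W.baseChange K).toAffine.Point}
    (hHP : IsHeegnerPoint N W K P)
    (h372 : GrossLMS1991.prop37_2_reductionCongruence_inert N W K)
    (h53 : ∀ [W.IsElliptic] (_hK : IsImaginaryQuadratic K) (_hH : SatisfiesHeegnerHypothesis N K)
      (Dt : ModularParametrizationData W N) (β : ℤ) (ι : K →+* ℂ) {M : ℕ}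
      (_hM : 1 ≤ M) {n : ℕ} (_hn : Squarefree n)
      (_hKol : ∀ q ∈ n.primeFactors, IsKolyvaginPrime N W K 2 q ∧ FrobEqFrobInfty W K (2 ^ M) q)
      (d : (m : ℕ) → m ∣ n → KolyvaginHeegnerData Dt β ι m) (m : ℕ) (hm : m ∣ n)
      (τm : ringClassField K ι m ≃ₐ[ℚ] ringClassField K ι m),
      (∀ x : ringClassField K ι m, ((τm x : ringClassField K ι m) : ℂ) = starRingEnd ℂ x) →
      ∃ σ' ∈ ringClassGal ι m, IsOfFinAddOrder
        (pointGalHom W (ringClassField K ι m) τm (d m hm).y -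
          (-W.rootNumber) • pointGalHom W (ringClassField K ι m) σ' (d m hm).y))
    (S : ℕ → Prop) :
    Nonempty (Rank1Residual.P2.KolyvaginMachine.PointSystemFamily N W K P 2 S) := by
  refine ⟨fun M hM hdiv c hc ↦ Classical.choice ?_⟩
  obtain ⟨ε, τ, hτ, A, hA, Pt, hPt, hε, hc1, hAτ, hPt1, hrel⟩ :=
    hpoints_two_of_cmInert_of_oddTamagawa hN hCMW hin hsurj hT hK hodd h3 hH hHP h372 h53 hM hdiv c hc
  exact ⟨⟨ε, τ, hτ, A, hA, Pt, hPt, hε, hc1, hAτ, hPt1,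
    fun m hm hq ↦ hrel m hm fun q hq' ↦ ⟨(hq q hq').1, (hq q hq').2.1⟩⟩⟩

/-! ## §3 The level-zero class theorem on H₂ for a prime Heegner field: binders = prints + {3.7 (2), 5.3} -/

/-- **THE LEVEL-ZERO CLASS THEOREM on H₂ for a prime Heegner field, hGZ31-FREE and plumbing-free.**
cmk2-p1 g9's `CMLevelZeroTwo.bsdp_two_of_levelZero_primeHeegner_of_pointSystem_of_plumbing` with its
three non-print inputs supplied BY NAME: the point-system DATA `D` by
`nonempty_pointSystemFamily_two_of_cmInert_of_oddTamagawa` (the habitat's own `Odd W.tamagawaProduct`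
replaces [GZ86 III (3.1)]), and the plumbing binders (tower) / (desc-fin) by ty2 g22's
`RationalDescentPlumbing.htower_two_pow_one` / `hdescfin_two_pow_one` (the place `u` over `q` chosen
inside). What is displayed: the five PRINT facts {modularity `exists_isNewformOf`, Gross–Zagier at all
levels, Gross–Zagier–Kolyvagin rank `≤ 1`, Milne 1972 quadratic base change, Burungale–Flach 2024 for
the CM twin}, the named fact `prop37_2_reductionCongruence_inert N_E W K` (Gross Prop. 3.7 (2)) and the
ONE printed statement `h53` (Gross Prop. 5.3) — for every `W ∈ H₂` (CM, `2` inert, `ρ̄₂` onto,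
`r_an = 1`, odd Tamagawa product, globally minimal), every prime Heegner field `K = ℚ(√−q)` (odd
`d_K ≠ −3`) and every frame whose `y_K` has infinite order and is not `2`-divisible in `E(K[1])`.
[cite: GrossLMS1991, §1 (1.2), Prop. 2.1 with §10, Props. 3.7, 5.3, 5.4, 6.2]
[cite: McCallumLMS1991, §1 Theorem, §4 Prop. 4.4, §5 Lemma 5.1] [cite: GrossZagier1986, Thm. I.6.3,
V.§2 (pp. 310–312)] [cite: BurungaleFlach2024, Thm. 1.1 and Cor. 2] [cite: Milne1972ArithmeticAV, §1
Thm. 1] [cite: MilneADT2006, Ch. I Prop. 3.8 and §6] -/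
theorem bsdp_two_of_levelZero_primeHeegner_of_oddTamagawa_of_print (hmod : exists_isNewformOf)
    (hGZ : ∀ (N : ℕ) [NeZero N] (W : WeierstrassCurve ℚ) (K : Type) [Field K] [NumberField K],
      gross_zagier N W K)
    (hGZK : rank_eq_analyticRank_of_analyticRank_le_one)
    (hMilne : Milne1972.bsdQuotient_baseChange_quadratic_anyModel)
    (hBF : bsdTriple_of_hasCM_of_L_one_ne_zero)
    (W : WeierstrassCurve ℚ) [W.IsElliptic] [W.IsGloballyMinimal] [NeZero (W.conductorNorm ℤ)]
    (hCM : W.HasCM) (hin : CMInert W 2) (hsurj : W.HasSurjectiveModNGaloisRep (2 : ℤ))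
    (hr : W.analyticRank = 1) (hT : Odd W.tamagawaProduct)
    (K : Type) [Field K] [NumberField K] (hK : IsImaginaryQuadratic K)
    (hodd : Odd (NumberField.discr K)) (h3 : NumberField.discr K ≠ -3)
    (hH : SatisfiesHeegnerHypothesis (W.conductorNorm ℤ) K)
    {q : ℕ} (hq : q.Prime) (hd : NumberField.discr K = -(q : ℤ))
    (h372 : GrossLMS1991.prop37_2_reductionCongruence_inert (W.conductorNorm ℤ) W K)
    (h53 : ∀ [W.IsElliptic] (_hK : IsImaginaryQuadratic K)
      (_hH : SatisfiesHeegnerHypothesis (W.conductorNorm ℤ) K)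
      (Dt : ModularParametrizationData W (W.conductorNorm ℤ)) (β : ℤ) (ι : K →+* ℂ) {M : ℕ}
      (_hM : 1 ≤ M) {n : ℕ} (_hn : Squarefree n)
      (_hKol : ∀ q ∈ n.primeFactors,
        IsKolyvaginPrime (W.conductorNorm ℤ) W K 2 q ∧ FrobEqFrobInfty W K (2 ^ M) q)
      (d : (m : ℕ) → m ∣ n → KolyvaginHeegnerData Dt β ι m) (m : ℕ) (hm : m ∣ n)
      (τm : ringClassField K ι m ≃ₐ[ℚ] ringClassField K ι m),
      (∀ x : ringClassField K ι m, ((τm x : ringClassField K ι m) : ℂ) = starRingEnd ℂ x) →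
      ∃ σ' ∈ ringClassGal ι m, IsOfFinAddOrder
        (pointGalHom W (ringClassField K ι m) τm (d m hm).y -
          (-W.rootNumber) • pointGalHom W (ringClassField K ι m) σ' (d m hm).y))
    (Dt : ModularParametrizationData W (W.conductorNorm ℤ))
    (hopt : ∀ z ∈ Dt.L.lattice, ∃ w ∈ periodLattice Dt.f, z = (Dt.c : ℂ) * w) (hc : Odd Dt.c)
    (β : ℤ) (ι : K →+* ℂ) (d₁ : KolyvaginHeegnerData Dt β ι 1) (hy : ¬ IsOfFinAddOrder d₁.derivedPoint)
    (h2 : ¬ ∃ Q : (W.baseChange (ringClassField K ι 1)).toAffine.Point,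
      (2 : ℤ) • Q = d₁.derivedPoint) :
    BSDp W 2 := by
  -- the place `u` of `ℚ` over the ramified prime `q`
  obtain ⟨u, hu⟩ : ∃ u : HeightOneSpectrum (𝓞 ℚ),
      ((Rat.HeightOneSpectrum.primesEquiv u : Nat.Primes) : ℕ) = q :=
    ⟨(Rat.HeightOneSpectrum.primesEquiv (R := 𝓞 ℚ)).symm ⟨q, hq⟩, by rw [Equiv.apply_symm_apply]⟩
  exact CMLevelZeroTwo.bsdp_two_of_levelZero_primeHeegner_of_pointSystem_of_plumbing hmod hGZ hGZK
    hMilne hBF W hCM hin hsurj hr hT K hK hodd h3 hH hq hd u hu Dt hopt hc β ι d₁ hy h2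
    (fun P₀ hP₀ ↦ Classical.choice
      (nonempty_pointSystemFamily_two_of_cmInert_of_oddTamagawa (N := W.conductorNorm ℤ) rfl hCM hin
        hsurj hT hK hodd h3 hH hP₀ h372 h53 _))
    (RationalDescentPlumbing.htower_two_pow_one W K)
    (RationalDescentPlumbing.hdescfin_two_pow_one W hK hH hq hd u hu)

/-! ## §4 The same BY NAME: every non-print input a kernel theorem or a NAMED Literature fact -/

/-- **THE LEVEL-ZERO CLASS THEOREM on H₂ for a prime Heegner field, ALL INPUTS BY NAME.** §3's
`bsdp_two_of_levelZero_primeHeegner_of_oddTamagawa_of_print` with its last displayed printed binder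
`h53` (Gross 1991, Prop. 5.3) fed by the Literature named fact
`Darmon2004.prop311_complexConjugation` (Darmon 2004, Prop. 3.11 — the CM-agnostic print of the same
statement) through its proved bridge `.h53`. Displayed inputs: the five PRINT facts {modularity
`exists_isNewformOf`, Gross–Zagier at all levels, Gross–Zagier–Kolyvagin rank `≤ 1`, Milne 1972,
Burungale–Flach 2024 for the CM twin} and the two NAMED facts `prop37_2_reductionCongruence_inert N_E W K`
(Gross Prop. 3.7 (2) = Nekovář Prop. 4.9) and `prop311_complexConjugation` (Darmon Prop. 3.11 =
Gross Prop. 5.3); everything else — point system, plumbing, admissibility, `a_ℓ = 0`, McCallum 4.4 at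
the supersingular Kolyvagin primes, Gross 6.2 (1) at every `v ∤ m` — is a theorem of the tree.
Conclusion: `BSD₂(E)` for every `W ∈ H₂` (CM, `2` inert, `ρ̄₂` onto, `r_an = 1`, odd Tamagawa product,
globally minimal), every prime Heegner field `K = ℚ(√−q)` (odd `d_K ≠ −3`) and every frame whose
`y_K` has infinite order and is not `2`-divisible in `E(K[1])`. [cite: GrossLMS1991, §1 (1.2),
Prop. 2.1 with §10, Props. 3.7, 5.3, 5.4, 6.2] [cite: McCallumLMS1991, §1 Theorem, §4 Prop. 4.4, §5
Lemma 5.1] [cite: Darmon2004, Prop. 3.11 (p. 36)] [cite: GrossZagier1986, Thm. I.6.3, V.§2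
(pp. 310–312)] [cite: BurungaleFlach2024, Thm. 1.1 and Cor. 2] [cite: Milne1972ArithmeticAV, §1
Thm. 1] -/
theorem bsdp_two_of_levelZero_primeHeegner_of_print (hmod : exists_isNewformOf)
    (hGZ : ∀ (N : ℕ) [NeZero N] (W : WeierstrassCurve ℚ) (K : Type) [Field K] [NumberField K],
      gross_zagier N W K)
    (hGZK : rank_eq_analyticRank_of_analyticRank_le_one)
    (hMilne : Milne1972.bsdQuotient_baseChange_quadratic_anyModel)
    (hBF : bsdTriple_of_hasCM_of_L_one_ne_zero)
    (h311 : Darmon2004.prop311_complexConjugation)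
    (W : WeierstrassCurve ℚ) [W.IsElliptic] [W.IsGloballyMinimal] [NeZero (W.conductorNorm ℤ)]
    (hCM : W.HasCM) (hin : CMInert W 2) (hsurj : W.HasSurjectiveModNGaloisRep (2 : ℤ))
    (hr : W.analyticRank = 1) (hT : Odd W.tamagawaProduct)
    (K : Type) [Field K] [NumberField K] (hK : IsImaginaryQuadratic K)
    (hodd : Odd (NumberField.discr K)) (h3 : NumberField.discr K ≠ -3)
    (hH : SatisfiesHeegnerHypothesis (W.conductorNorm ℤ) K)
    {q : ℕ} (hq : q.Prime) (hd : NumberField.discr K = -(q : ℤ))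
    (h372 : GrossLMS1991.prop37_2_reductionCongruence_inert (W.conductorNorm ℤ) W K)
    (Dt : ModularParametrizationData W (W.conductorNorm ℤ))
    (hopt : ∀ z ∈ Dt.L.lattice, ∃ w ∈ periodLattice Dt.f, z = (Dt.c : ℂ) * w) (hc : Odd Dt.c)
    (β : ℤ) (ι : K →+* ℂ) (d₁ : KolyvaginHeegnerData Dt β ι 1) (hy : ¬ IsOfFinAddOrder d₁.derivedPoint)
    (h2 : ¬ ∃ Q : (W.baseChange (ringClassField K ι 1)).toAffine.Point,
      (2 : ℤ) • Q = d₁.derivedPoint) :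
    BSDp W 2 :=
  bsdp_two_of_levelZero_primeHeegner_of_oddTamagawa_of_print hmod hGZ hGZK hMilne hBF W hCM hin hsurj hr
    hT K hK hodd h3 hH hq hd h372 (h311.h53 rfl) Dt hopt hc β ι d₁ hy h2

end Summit.BirchSwinnertonDyer.Rank1Residual.P2.PointSystemOddTamagawa

end
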